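import Mathlib
import HarnessLib
import Summits.NavierStokesRegularity.NavierStokesRegularity.Theorems.PoloidalWindowDoorPoloidalWindowRigidityEllipticSlope
import Summits.NavierStokesRegularity.NavierStokesRegularity.Theorems.PoloidalWindowDoorPoloidalWindowRigidityDivFormLiouvilleAll

/-!
# Route `PoloidalWindowDoor`, crux K2 (stmt-NavierStokesRegularity-19708) — the ELLIPTIC-SLOPE STRATUM IS EMPTY, UNCONDITIONALLY

The K2 lead's mechanism M11 (`…EllipticSlope`, p482138) proved that the elliptic-slope stratum of the crux's residue is
empty CONDITIONALLY on the named fact `Literature.Analysis.PDE.divFormLiouville` (De Giorgi–Nash–Moser Liouville).  That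
fact is now a theorem of the tree (`Literature.Analysis.PDE.divFormLiouville_holds`, file `…DivFormLiouvilleAll`, seat
ns-poloidal-K2-p3 g2, task H5); this file records the unconditional corollaries, with the hypothesis `hDGNM` discharged.

* `eq_zero_of_ellipticShear'`, `eq_zero_of_clebschSlope_offInterval'`, `nonflatLiouville_of_ellipticShear'`.

WHAT THIS IS NOT: not the crux (S2″ `stub_residueAperiodicCriticalStrain` stays open) — one stratum, now kernel-unconditional.
-/

noncomputable section

-- the summit and its single sub-problem share the name (CONVENTIONS §1), as in every Theorems file
set_option linter.dupNamespace false

namespace Summit.NavierStokesRegularity.NavierStokesRegularity.Theorems.PoloidalWindowDoorPoloidalWindowRigidityEllipticSlopeUnconditional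

open Set Function Filter Topology
open scoped RealInnerProductSpace InnerProductSpace
open Literature.Analysis Literature.Analysis.FluidPDE
open Summit.NavierStokesRegularity.NavierStokesRegularity.Theorems.PoloidalWindowDoorPoloidalWindowRigidityFlat
open Summit.NavierStokesRegularity.NavierStokesRegularity.Theorems.PoloidalWindowDoorPoloidalWindowRigidityEllipticSlope

variable {C : ℝ} {v : ℝ → EuclideanSpace ℝ (Fin 3) → EuclideanSpace ℝ (Fin 3)}

/-- **The elliptic-slope stratum is empty — unconditionally** (M11 with `hDGNM := divFormLiouville_holds`). -/
theorem eq_zero_of_ellipticShear' (hrate : HasTypeITimeDecay C v)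
    (hcont : ContinuousOn (uncurry v) (Iio (0 : ℝ) ×ˢ univ))
    (hmild : ∀ s t : ℝ, s < t → t < 0 → ∀ x,
      v t x = UnboundedOperators.heatExtension (v s) (t - s) x - oseenDuhamel 1 s v v t x)
    (hdiv : ∀ t < 0, VectorCalculus.IsDivFree (v t)) {s : ℝ} (hs : s < 0)
    (hpol : ∀ y, ⟪curl (v s) y, EuclideanSpace.single 2 1⟫_ℝ = 0)
    {μ₀ μ₁ : ℝ} (hμ₀ : 0 < μ₀)
    (hshear : ∀ y, ∃ m : ℝ, μ₀ ≤ m ∧ m ≤ μ₁ ∧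
      fderiv ℝ (v s) y (EuclideanSpace.single 2 1) 0 = m * fderiv ℝ (v s) y (EuclideanSpace.single 0 1) 2 ∧
      fderiv ℝ (v s) y (EuclideanSpace.single 2 1) 1 = m * fderiv ℝ (v s) y (EuclideanSpace.single 1 1) 2) :
    ∀ t < 0, ∀ x, v t x = 0 :=
  eq_zero_of_ellipticShear Literature.Analysis.PDE.divFormLiouville_holds hrate hcont hmild hdiv hs hpol hμ₀ hshear

/-- **Off-interval Clebsch slope ⇒ zero — unconditionally** (slope currency of M11). -/
theorem eq_zero_of_clebschSlope_offInterval' (hrate : HasTypeITimeDecay C v)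
    (hcont : ContinuousOn (uncurry v) (Iio (0 : ℝ) ×ˢ univ))
    (hmild : ∀ s t : ℝ, s < t → t < 0 → ∀ x,
      v t x = UnboundedOperators.heatExtension (v s) (t - s) x - oseenDuhamel 1 s v v t x)
    (hdiv : ∀ t < 0, VectorCalculus.IsDivFree (v t)) {s : ℝ} (hs : s < 0)
    (hpol : ∀ y, ⟪curl (v s) y, EuclideanSpace.single 2 1⟫_ℝ = 0)
    {δ : ℝ} (hδ : 0 < δ)
    (hslope : ∀ y, ∃ lam : ℝ, (lam ≤ -δ ∨ 1 + δ ≤ lam) ∧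
      fderiv ℝ (v s) y (EuclideanSpace.single 0 (1 : ℝ)) 2 = -(lam * curl (v s) y 1) ∧
      fderiv ℝ (v s) y (EuclideanSpace.single 1 (1 : ℝ)) 2 = lam * curl (v s) y 0) :
    ∀ t < 0, ∀ x, v t x = 0 :=
  eq_zero_of_clebschSlope_offInterval Literature.Analysis.PDE.divFormLiouville_holds hrate hcont hmild hdiv hs hpol hδ
    hslope

/-- **Stub currency, unconditional**: an elliptic-shear slice rules out a backward singular point at the origin. -/
theorem nonflatLiouville_of_ellipticShear' (hrate : HasTypeITimeDecay C v)
    (hcont : ContinuousOn (uncurry v) (Iio (0 : ℝ) ×ˢ univ))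
    (hmild : ∀ s t : ℝ, s < t → t < 0 → ∀ x,
      v t x = UnboundedOperators.heatExtension (v s) (t - s) x - oseenDuhamel 1 s v v t x)
    (hdiv : ∀ t < 0, VectorCalculus.IsDivFree (v t)) {s : ℝ} (hs : s < 0)
    (hpol : ∀ y, ⟪curl (v s) y, EuclideanSpace.single 2 1⟫_ℝ = 0)
    {μ₀ μ₁ : ℝ} (hμ₀ : 0 < μ₀)
    (hshear : ∀ y, ∃ m : ℝ, μ₀ ≤ m ∧ m ≤ μ₁ ∧
      fderiv ℝ (v s) y (EuclideanSpace.single 2 1) 0 = m * fderiv ℝ (v s) y (EuclideanSpace.single 0 1) 2 ∧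
      fderiv ℝ (v s) y (EuclideanSpace.single 2 1) 1 = m * fderiv ℝ (v s) y (EuclideanSpace.single 1 1) 2) :
    ¬ IsBackwardSingularPoint v 0 :=
  nonflatLiouville_of_ellipticShear Literature.Analysis.PDE.divFormLiouville_holds hrate hcont hmild hdiv hs hpol hμ₀ hshear

end Summit.NavierStokesRegularity.NavierStokesRegularity.Theorems.PoloidalWindowDoorPoloidalWindowRigidityEllipticSlopeUnconditional

end
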